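import Literature.AnabelianGeometry.SemiGraphs.TemperedDecompositionExists
import Literature.AnabelianGeometry.SemiGraphs.OneVertexEdgelessChart
import Literature.AnabelianGeometry.SemiGraphs.TemperedVerticialNamedFactsProofs
import Literature.AnabelianGeometry.SemiGraphs.ArithEdgeLikeTwoHosts
import HarnessLib

/-!
# The decomposition subgroups of the edgeless single-vertex sub-semi-graph `{v}` ARE the verticial subgroups
# at `v` ([IUTchI] §2 p. 44 / Prop. 2.2; [SemiAnbd] Thm. 3.7 (i), (ii))

Mochizuki, *Inter-universal Teichmüller theory I*, §2 p. 44 l. 39–44 (decomposition groups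
`Π^tp_ℍ ⊆ Π^tp_𝔾` of a sub-semi-graph `ℍ`, "well-defined up to conjugation"), Prop. 2.2 p. 45 (the third
commensurably terminal inclusion `Π^tp_ℍ ⊆ Π^tp_𝔾`) [cite: Mochizuki2012, IUTchI §2 p.44]; Mochizuki,
*Semi-graphs of anabelioids*, Publ. RIMS **42** (2006), §3 Thm. 3.7 (i) p. 40 ("for each vertex `v` of `G`,
there is a natural continuous, injective outer homomorphism `π̂₁(G_v) ↪ π₁^temp(G)` … the verticial
subgroups"), (ii) p. 40 (verticial subgroups are commensurably terminal), Def. 2.1 p. 24 (`𝒢_ℍ`)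
[cite: MochizukiSemiAnbd2006, Thm 3.7(i) p.40].

PROOF-ONLY companion (abc-iut cell, layer L3, row «DECOMP@SINGLE-VERTEX» = GAP row G-w5d028-2 sub-row
γ-2, L3-lead rulings β50 (1) / β57 (2); seat abc-iut-L3-t6 gen 7) of abc-iut-w4-d052's
`TemperedDecompositionSubgroups.lean` / `TemperedDecompositionExists.lean` (the decomposition subgroups
`TemperedPiChart.decompSubgroups c ℍ`, one conjugacy class, non-empty) and of the DEFINITIONS file
`OneVertexEdgelessChart.lean` (the explicit chart `chartSingleVertex 𝒢 v` of `𝒢_{⟨{v}, ∅⟩}` with group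
`Π_v`, for which `B^temp(𝒢) → B^temp(𝒢_{⟨{v}, ∅⟩}) → B^temp(Π_v)` IS `S ↦ S_v`).  At the EDGELESS
single-vertex sub-semi-graph `⟨{v}, ∅⟩` (written literally; no new definition):

* `isDecompHom_singleVertex_iff` — `φ : Π_v → π₁^temp(𝒢)` is a decomposition homomorphism of `{v}` for
  the chart `chartSingleVertex` iff it is a verticial homomorphism at `v` (`Iff.rfl`: the two restriction
  functors agree on the nose, abc-iut-L3-t2's `covRestrict_comp_restrictV`);
* `exists_isVerticialHom_comp_of_isDecompHom` / `isDecompHom_comp_of_isVerticialHom` — the same for ANY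
  chart of `𝒢_{⟨{v}, ∅⟩}`, through the compatible isomorphism `Π_v ≅ π₁^temp(𝒢_{⟨{v}, ∅⟩})`
  (`TemperedPiChart.exists_compatIso`, abc-iut's chart transport);
* `verticialSubgroups_subset_decompSubgroups_singleVertex` and
  **`decompSubgroups_singleVertex_eq : c.decompSubgroups ⟨{v}, ∅⟩ = verticialSubgroups c v`** — EQUAL
  OUTRIGHT for `𝒢` quasi-coherent and Galois-countable (the inputs under which verticial homomorphisms
  exist, `exists_isVerticialHom`, and `Π_v` is second countable, `secondCountableTopology_Gv`): `⊇` by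
  the first item, `⊆` because both sides are ONE conjugacy class (abc-iut-w4-d052's
  `exists_conj_of_mem_decompSubgroups`, `conj_mem_verticialSubgroups`);
* **`decompSubgroupsCommensurablyTerminal_singleVertex`** — abc-iut-w4-d052's named target (P2)
  ([IUTchI] Prop. 2.2, third inclusion) AT SINGLE VERTICES: by the equality it is [SemiAnbd] Thm. 3.7 (ii)
  (`commensurator_eq_of_mem_verticialSubgroups`, i.e. `verticialDistinct_holds`) — no new argument.

HONEST SCOPE: `⟨{v}, ∅⟩` is the edgeless single vertex; the "star" `𝒢_v` of [SemiAnbd] p. 24 (the edges at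
`v` kept, open at their far ends) has the same `B^temp` only when no edge is a loop at `v` — not treated;
(P2) for a general sub-semi-graph stays abc-iut-w4-d052's named target.  Proof-only: 0 definitions, no
instance, no notation, no `Prop` fact.  Nothing here takes a side on [IUTchIII] Cor. 3.12.
-/

namespace Literature.AnabelianGeometry.SemiGraphs

namespace ProfiniteSemiGraph

open CategoryTheory
open Literature.AnabelianGeometry.AbsoluteAnabelian (IsCommensurablyTerminal)

universe u

variable {𝒢 : ProfiniteSemiGraph.{u}}

namespace TemperedPiChart

/-! ### Decomposition homomorphisms of `{v}` = verticial homomorphisms at `v` -/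

/-- **For the chart `chartSingleVertex 𝒢 v` (group `Π_v`) of `𝒢_{⟨{v}, ∅⟩}`, a continuous
`φ : Π_v → π₁^temp(𝒢)` is a decomposition homomorphism of the sub-semi-graph `{v}` iff it is a verticial
homomorphism at `v`**: both say `B^temp(φ) ≅ (S ↦ S_v)` read through the chart `c` — the restriction to
`𝒢_{⟨{v}, ∅⟩}` followed by the chart `Π_v` IS `S ↦ S_v` (`btempRestrict_comp_chartSingleVertex_functor`).
[cite: MochizukiSemiAnbd2006, Thm 3.7(i) p.40] -/
theorem isDecompHom_singleVertex_iff (c : TemperedPiChart 𝒢) (v : 𝒢.graph.Vertex)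
    [SecondCountableTopology (𝒢.Gv v)] (φ : 𝒢.Gv v →ₜ* c.G) :
    c.IsDecompHom ⟨{v}, ∅⟩ (chartSingleVertex 𝒢 v) φ ↔ IsVerticialHom c v φ :=
  Iff.rfl

/-- A verticial homomorphism at `v` is a decomposition homomorphism of `{v}` (chart `Π_v`).
[cite: Mochizuki2012, IUTchI §2 p.44] -/
theorem isDecompHom_singleVertex_of_isVerticialHom (c : TemperedPiChart 𝒢) (v : 𝒢.graph.Vertex)
    [SecondCountableTopology (𝒢.Gv v)] {φ : 𝒢.Gv v →ₜ* c.G} (hφ : IsVerticialHom c v φ) :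
    c.IsDecompHom ⟨{v}, ∅⟩ (chartSingleVertex 𝒢 v) φ :=
  (isDecompHom_singleVertex_iff c v φ).mpr hφ

/-- **The same for ANY chart `c'` of `𝒢_{⟨{v}, ∅⟩}`**: a decomposition homomorphism `φ' : c'.G → π₁^temp(𝒢)`
of `{v}` becomes a verticial homomorphism at `v` after composition with the compatible isomorphism
`χ : Π_v ⥲ c'.G` of the two charts of `𝒢_{⟨{v}, ∅⟩}` (`TemperedPiChart.exists_compatIso`; `ω` is its
inverse). [cite: MochizukiSemiAnbd2006, Prop 3.6(ii) p.38] -/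
theorem exists_isVerticialHom_comp_of_isDecompHom (c : TemperedPiChart 𝒢) (v : 𝒢.graph.Vertex)
    [SecondCountableTopology (𝒢.Gv v)] (c' : TemperedPiChart (𝒢.restrict ⟨{v}, ∅⟩))
    {φ' : c'.G →ₜ* c.G} (h : c.IsDecompHom ⟨{v}, ∅⟩ c' φ') :
    ∃ (χ : 𝒢.Gv v →ₜ* c'.G) (ω : c'.G →ₜ* 𝒢.Gv v), (∀ x, ω (χ x) = x) ∧ (∀ y, χ (ω y) = y) ∧
      IsVerticialHom c v (φ'.comp χ) ∧ c.IsDecompHom ⟨{v}, ∅⟩ c' ((φ'.comp χ).comp ω) := by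
  obtain ⟨χ, ω, hωχ, hχω, hχ, hω⟩ := TemperedPiChart.exists_compatIso (chartSingleVertex 𝒢 v) c'
  refine ⟨χ, ω, hωχ, hχω, (isDecompHom_singleVertex_iff c v (φ'.comp χ)).mp (h.comp_compat χ hχ), ?_⟩
  exact (h.comp_compat χ hχ).comp_compat ω hω

/-- Conversely a verticial homomorphism `ψ : Π_v → π₁^temp(𝒢)` composed with the compatible isomorphism
`ω : c'.G ⥲ Π_v` is a decomposition homomorphism of `{v}` for ANY chart `c'` of `𝒢_{⟨{v}, ∅⟩}`.
[cite: Mochizuki2012, IUTchI §2 p.44] -/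
theorem exists_isDecompHom_comp_of_isVerticialHom (c : TemperedPiChart 𝒢) (v : 𝒢.graph.Vertex)
    [SecondCountableTopology (𝒢.Gv v)] (c' : TemperedPiChart (𝒢.restrict ⟨{v}, ∅⟩))
    {ψ : 𝒢.Gv v →ₜ* c.G} (hψ : IsVerticialHom c v ψ) :
    ∃ (χ : 𝒢.Gv v →ₜ* c'.G) (ω : c'.G →ₜ* 𝒢.Gv v), (∀ x, ω (χ x) = x) ∧ (∀ y, χ (ω y) = y) ∧
      c.IsDecompHom ⟨{v}, ∅⟩ c' (ψ.comp ω) := by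
  obtain ⟨χ, ω, hωχ, hχω, -, hω⟩ := TemperedPiChart.exists_compatIso (chartSingleVertex 𝒢 v) c'
  exact ⟨χ, ω, hωχ, hχω, (isDecompHom_singleVertex_of_isVerticialHom c v hψ).comp_compat ω hω⟩

/-! ### `decompSubgroups c {v} = verticialSubgroups c v` -/

/-- **Every verticial subgroup at `v` is a decomposition subgroup of `{v}`** (`Π_v` second countable, so
that `chartSingleVertex` is available). [cite: Mochizuki2012, IUTchI §2 p.44] -/
theorem verticialSubgroups_subset_decompSubgroups_singleVertex (c : TemperedPiChart 𝒢)
    (v : 𝒢.graph.Vertex) [SecondCountableTopology (𝒢.Gv v)] :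
    verticialSubgroups c v ⊆ c.decompSubgroups ⟨{v}, ∅⟩ := by
  rintro H ⟨φ, hφ, rfl⟩
  exact ⟨chartSingleVertex 𝒢 v, φ, isDecompHom_singleVertex_of_isVerticialHom c v hφ, rfl⟩

/-- A decomposition subgroup of `{v}` is verticial at `v` as soon as SOME verticial subgroup at `v` exists:
both families are single conjugacy classes (`exists_conj_of_mem_decompSubgroups`,
`conj_mem_verticialSubgroups`). [cite: Mochizuki2012, IUTchI §2 p.44] -/
theorem decompSubgroups_singleVertex_subset_of_nonempty (c : TemperedPiChart 𝒢) (v : 𝒢.graph.Vertex)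
    [SecondCountableTopology (𝒢.Gv v)] (hne : (verticialSubgroups c v).Nonempty) :
    c.decompSubgroups ⟨{v}, ∅⟩ ⊆ verticialSubgroups c v := by
  intro D hD
  obtain ⟨H₀, hH₀⟩ := hne
  obtain ⟨g, rfl⟩ := exists_conj_of_mem_decompSubgroups
    (verticialSubgroups_subset_decompSubgroups_singleVertex c v hH₀) hD
  exact conj_mem_verticialSubgroups c hH₀ g

/-- The equality under second countability of `Π_v` and existence of one verticial subgroup.
[cite: Mochizuki2012, IUTchI §2 p.44] -/
theorem decompSubgroups_singleVertex_eq_of_nonempty (c : TemperedPiChart 𝒢) (v : 𝒢.graph.Vertex)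
    [SecondCountableTopology (𝒢.Gv v)] (hne : (verticialSubgroups c v).Nonempty) :
    c.decompSubgroups ⟨{v}, ∅⟩ = verticialSubgroups c v :=
  Set.Subset.antisymm (decompSubgroups_singleVertex_subset_of_nonempty c v hne)
    (verticialSubgroups_subset_decompSubgroups_singleVertex c v)

/-- **`Π^tp_{{v}} = π̂₁(G_v)`: the decomposition subgroups of the edgeless single-vertex sub-semi-graph
`{v}` ARE the verticial subgroups at `v`** — EQUAL as sets of subgroups of `π₁^temp(𝒢)`, for `𝒢`
quasi-coherent and Galois-countable (then `Π_v` is second countable, `secondCountableTopology_Gv`, and a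
verticial homomorphism exists, `exists_isVerticialHom` = Thm. 3.7 (i)). [cite: Mochizuki2012, IUTchI §2 p.44] -/
theorem decompSubgroups_singleVertex_eq (hqc : 𝒢.IsQuasiCoherent) (hgc : 𝒢.IsGaloisCountable)
    (c : TemperedPiChart 𝒢) (v : 𝒢.graph.Vertex) : c.decompSubgroups ⟨{v}, ∅⟩ = verticialSubgroups c v := by
  haveI : SecondCountableTopology (𝒢.Gv v) := secondCountableTopology_Gv hqc hgc v
  exact decompSubgroups_singleVertex_eq_of_nonempty c v (verticialSubgroups_nonempty hqc hgc c v)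

/-- The same under the hypotheses of [SemiAnbd] Prop. 3.6 (which contain quasi-coherence and
Galois-countability). [cite: Mochizuki2012, IUTchI §2 p.44] -/
theorem decompSubgroups_singleVertex_eq_of_prop36 (h36 : 𝒢.Prop36Hypotheses) (c : TemperedPiChart 𝒢)
    (v : 𝒢.graph.Vertex) : c.decompSubgroups ⟨{v}, ∅⟩ = verticialSubgroups c v :=
  decompSubgroups_singleVertex_eq h36.isQuasiCoherent h36.isGaloisCountable c v

/-- Membership form: `D` is a decomposition subgroup of `{v}` iff it is a verticial subgroup at `v`.
[cite: Mochizuki2012, IUTchI §2 p.44] -/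
theorem mem_decompSubgroups_singleVertex_iff (hqc : 𝒢.IsQuasiCoherent) (hgc : 𝒢.IsGaloisCountable)
    (c : TemperedPiChart 𝒢) (v : 𝒢.graph.Vertex) (D : Subgroup c.G) :
    D ∈ c.decompSubgroups ⟨{v}, ∅⟩ ↔ D ∈ verticialSubgroups c v := by
  rw [decompSubgroups_singleVertex_eq hqc hgc c v]

/-- The decomposition subgroups of `{v}` are non-empty (either by the equality and Thm. 3.7 (i), or by
abc-iut-w4-d052's `decompSubgroups_nonempty` at the chart `chartSingleVertex`).
[cite: Mochizuki2012, IUTchI §2 p.44] -/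
theorem decompSubgroups_singleVertex_nonempty (hqc : 𝒢.IsQuasiCoherent) (hgc : 𝒢.IsGaloisCountable)
    (c : TemperedPiChart 𝒢) (v : 𝒢.graph.Vertex) : (c.decompSubgroups ⟨{v}, ∅⟩).Nonempty := by
  haveI : SecondCountableTopology (𝒢.Gv v) := secondCountableTopology_Gv hqc hgc v
  exact decompSubgroups_nonempty c ⟨{v}, ∅⟩ (chartSingleVertex 𝒢 v)

/-- Decomposition subgroups of `{v}` are compact (they are verticial: images of the profinite `Π_v`).
[cite: MochizukiSemiAnbd2006, Thm 3.7(i) p.40] -/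
theorem isCompact_of_mem_decompSubgroups_singleVertex (hqc : 𝒢.IsQuasiCoherent)
    (hgc : 𝒢.IsGaloisCountable) (c : TemperedPiChart 𝒢) (v : 𝒢.graph.Vertex) {D : Subgroup c.G}
    (hD : D ∈ c.decompSubgroups ⟨{v}, ∅⟩) : IsCompact (D : Set c.G) :=
  isCompact_of_mem_verticialSubgroups c ((mem_decompSubgroups_singleVertex_iff hqc hgc c v D).mp hD)

/-! ### (P2) at single vertices: [IUTchI] Prop. 2.2 (third inclusion) for `ℍ = {v}` -/

/-- **abc-iut-w4-d052's named target (P2) `DecompSubgroupsCommensurablyTerminal` HOLDS at every edgeless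
single-vertex sub-semi-graph** of a `𝒢` as in [SemiAnbd] Thm. 3.7: `C_{π₁^temp(𝒢)}(D) = D` for every
`D ∈ decompSubgroups c ⟨{v}, ∅⟩` — these are the verticial subgroups at `v`, which are commensurably
terminal by Thm. 3.7 (ii) (`commensurator_eq_of_mem_verticialSubgroups`, from `verticialDistinct_holds`).
[cite: Mochizuki2012, IUTchI Prop 2.2 p.45] -/
theorem decompSubgroupsCommensurablyTerminal_singleVertex (h37 : 𝒢.Thm37Hypotheses) (c : TemperedPiChart 𝒢)
    (v : 𝒢.graph.Vertex) : c.DecompSubgroupsCommensurablyTerminal ⟨{v}, ∅⟩ := by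
  intro D hD
  rw [decompSubgroups_singleVertex_eq h37.isQuasiCoherent h37.isGaloisCountable c v] at hD
  exact ⟨commensurator_eq_of_mem_verticialSubgroups h37 c hD⟩

/-- The commensurator form: `C(D) = D` for every decomposition subgroup of `{v}`.
[cite: Mochizuki2012, IUTchI Prop 2.2 p.45] -/
theorem commensurator_eq_of_mem_decompSubgroups_singleVertex (h37 : 𝒢.Thm37Hypotheses)
    (c : TemperedPiChart 𝒢) (v : 𝒢.graph.Vertex) {D : Subgroup c.G}
    (hD : D ∈ c.decompSubgroups ⟨{v}, ∅⟩) : Subgroup.Commensurable.commensurator D = D :=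
  (decompSubgroupsCommensurablyTerminal_singleVertex h37 c v D hD).commensurator_eq

end TemperedPiChart

end ProfiniteSemiGraph

end Literature.AnabelianGeometry.SemiGraphs
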